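import Summits.Ventures.Crystal3D.Theorems.StickyWulffConstantTextureLiminfLineCountGlueComb
import HarnessLib

/-!
# The wall cell's charge against a PER-PLATE MIXTURE of the zigzag and in-layer families (what ONE payer budget buys)
# (LAYER-FLUX chain, MAX ruling; crux `TextureLiminf`, stmt-Ventures-19483; cf-p1 ROUTE.md §86(81b) RULING (xxxvii′))

HONEST FRAMING. Venture `Summits/Ventures/Crystal3D` (cell `crystal3d-full`), helper `--supports` the crux
`TextureLiminf` (stmt-Ventures-19483) of `route-Ventures-StickyWulffConstant`, registered line `TexShadow`.  Rung credit
only; F-C1 not moved.  NOT the wall law: a counting inequality (charge ≤ weighted line counts), whatever lane G can pay for.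

WHY WEIGHTS (the MAX question of RULING (xxxvii′), made precise).  Lane G's `walkerFamilies_card_le_payers` pays ONE walker family
per plate per budget: with the bottom plate's zigzag lines `T₁` / in-layer rows `T₃` and the top plate's `T₂` / `T₄` it certifies
each of the four PAIR bounds `#T₁+#T₂`, `#T₁+#T₄`, `#T₃+#T₂`, `#T₃+#T₄ ≤ Σ_PAY(12 − deg)` (given each family's launch/off-reach
hypotheses), but not `#T₁+#T₂+#T₃+#T₄ ≤ Σ_PAY` (SUM: two same-plate families need a hole-ownership lemma nobody has).  Expanding
`λμ·(1,2) + λ(1−μ)·(1,4) + (1−λ)μ·(3,2) + (1−λ)(1−μ)·(3,4)` shows the four pair bounds pay EXACTLY the per-plate convex mixtures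
`λ#T₁ + (1−λ)#T₃ + μ#T₂ + (1−μ)#T₄ ≤ Σ_PAY`, `λ, μ ∈ [0,1]` CONSTANT OVER STRIPS.  A per-STRIP maximum `max(plateFlux i, layerFlux)`
is NOT of this form (walkers travel across strips and meet at the same payers: the same ownership issue as SUM); for strip-constant
tables the corners `λ, μ ∈ {0,1}` suffice (`minᵢ` of the mixture is linear in `λ`, `layerFlux` being strip-independent).  Hence:

* `MixFluxDominated τ a₁ b₁ a₂ b₂ L₁ σ₁ L₂ σ₂ c` — `c i j ≤ ½ ((a₁·plateFlux₁ i + b₁·layerFlux₁) + (a₂·plateFlux₂ j + b₂·layerFlux₂))`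
  (ns TexShadow; `(1,0,1,0)` = `FluxDominated`, `(1,1,1,1)` = `SumFluxDominated`, the MAX corners = `a + b = 1` per plate in `{0,1}`);
* **`cell_charge_le_lines_mix`** / **`…_margin`** — for weights in `[0,1]` and every mix-dominated `c ≥ 0` (`1/4 ≤ τ₀`):
  `2·Q_ρ(c) ≤ a₁#T₁ + a₂#T₂ + b₁#T₃ + b₂#T₄ + 160(R₀+9)(1+h)ρ (+ 36mρ)`, same windows as `cell_charge_le_lines_comb(_margin)`;
* **`bilayerWallAt_of_lineCount_mix`** — F4-shaped deliverable with the WEIGHTED count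
  `a₁#T₁ + a₂#T₂ + b₁#T₃ + b₂#T₄ + 36mρ ≤ Σ_PAY(12−deg) + C_w(1+h)ρ` ⇒ `BilayerWallAt ((C_w + 160(R₀+9) + 3456 + 1152(R₀+1))/2) R₀ …`;
* `mixFluxDominated_of_fluxDominated`, `mixFluxDominated_of_sumFluxDominated`, `mixFluxDominated_mono` (bookkeeping).
WHAT THIS IS NOT: not the walker families, not the in-layer family's launch/off-reach predicates (lane G); F-C1 not moved.
-/

noncomputable section

namespace Summit.Ventures.Crystal3D.Cruxes.TextureLiminf.TexShadow

/-- **the charge table `c` is MIX-FLUX-DOMINATED at steepness `τ` with per-plate weights** `(a₁, b₁)` (bottom plate: zigzag,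
in-layer) and `(a₂, b₂)` (top plate): strip by strip `c i j ≤ ½ ((a₁·plateFlux₁ i + b₁·layerFlux₁) + (a₂·plateFlux₂ j + b₂·layerFlux₂))`. -/
def MixFluxDominated (τ a₁ b₁ a₂ b₂ : ℝ) (L₁ : E3 ≃ₗᵢ[ℝ] E3) (σ₁ : ℤ → ℤ) (L₂ : E3 ≃ₗᵢ[ℝ] E3) (σ₂ : ℤ → ℤ)
    (c : ℤ → ℤ → ℝ) : Prop :=
  ∀ i j : ℤ, c i j ≤ (a₁ * plateFlux τ L₁ σ₁ e₃ i + b₁ * layerFlux τ L₁ e₃ +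
    (a₂ * plateFlux τ L₂ σ₂ (-e₃) j + b₂ * layerFlux τ L₂ (-e₃))) / 2

end Summit.Ventures.Crystal3D.Cruxes.TextureLiminf.TexShadow

namespace Summit.Ventures.Crystal3D.Theorems

open MeasureTheory Set
open scoped ENNReal InnerProductSpace
open Literature.MathematicalPhysics.StatisticalMechanics (IsHaggSeq triangularVec₁ triangularVec₂)
open Summit.Ventures.Crystal3D.Cruxes.TextureLiminf.TexShadow (E3 e₃ cyl stacking laySlab bilayerRise PlateLaunchable plateFlux
  layerFlux layerFlux_nonneg layerFlux_le_sqrt_two FluxDominated SumFluxDominated MixFluxDominated BilayerWallAt)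

/-! ## Bookkeeping between the three domination predicates -/

/-- Zigzag-flux domination is mix domination with weights `(1,0,1,0)`. -/
theorem mixFluxDominated_of_fluxDominated {τ : ℝ} {L₁ L₂ : E3 ≃ₗᵢ[ℝ] E3} {σ₁ σ₂ : ℤ → ℤ} {c : ℤ → ℤ → ℝ}
    (h : FluxDominated τ L₁ σ₁ L₂ σ₂ c) : MixFluxDominated τ 1 0 1 0 L₁ σ₁ L₂ σ₂ c := fun i j => by
  have := h i j; simp only [one_mul, zero_mul, add_zero]; exact this

/-- Sum-flux domination is mix domination with weights `(1,1,1,1)`. -/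
theorem mixFluxDominated_of_sumFluxDominated {τ : ℝ} {L₁ L₂ : E3 ≃ₗᵢ[ℝ] E3} {σ₁ σ₂ : ℤ → ℤ} {c : ℤ → ℤ → ℝ}
    (h : SumFluxDominated τ L₁ σ₁ L₂ σ₂ c) : MixFluxDominated τ 1 1 1 1 L₁ σ₁ L₂ σ₂ c := fun i j => by
  have := h i j; simp only [one_mul]; exact this

/-- Mix domination is monotone in the weights (fluxes are nonnegative). -/
theorem mixFluxDominated_mono {τ a₁ b₁ a₂ b₂ a₁' b₁' a₂' b₂' : ℝ} {L₁ L₂ : E3 ≃ₗᵢ[ℝ] E3} {σ₁ σ₂ : ℤ → ℤ} {c : ℤ → ℤ → ℝ}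
    (ha₁ : a₁ ≤ a₁') (hb₁ : b₁ ≤ b₁') (ha₂ : a₂ ≤ a₂') (hb₂ : b₂ ≤ b₂')
    (h : MixFluxDominated τ a₁ b₁ a₂ b₂ L₁ σ₁ L₂ σ₂ c) : MixFluxDominated τ a₁' b₁' a₂' b₂' L₁ σ₁ L₂ σ₂ c := by
  have he₃ : ‖(e₃ : E3)‖ = 1 := by rw [e₃, PiLp.norm_single, norm_one]
  have hne₃ : ‖(-e₃ : E3)‖ = 1 := by rw [norm_neg, he₃]
  intro i j
  have h1 := mul_le_mul_of_nonneg_right ha₁ (plateFlux_nonneg τ L₁ σ₁ he₃ i)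
  have h2 := mul_le_mul_of_nonneg_right hb₁ (layerFlux_nonneg τ L₁ e₃)
  have h3 := mul_le_mul_of_nonneg_right ha₂ (plateFlux_nonneg τ L₂ σ₂ hne₃ j)
  have h4 := mul_le_mul_of_nonneg_right hb₂ (layerFlux_nonneg τ L₂ (-e₃))
  have := h i j
  linarith

/-! ## The weighted cell bound -/

/-- Splitting a weighted flux: `Σ'ᵢ (a·fᵢ + b)|X ∩ slabᵢ| = a·Σ'ᵢ fᵢ|X ∩ slabᵢ| + b|X|` (`0 ≤ a ≤ 1`, `0 ≤ fᵢ ≤ A`). -/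
theorem tsum_flux_scale_add_const (L : E3 ≃ₗᵢ[ℝ] E3) (s : E3) (f : ℤ → ℝ) (A a b : ℝ) (hf0 : ∀ i, 0 ≤ f i) (hfA : ∀ i, f i ≤ A)
    (ha0 : 0 ≤ a) (ha1 : a ≤ 1) (X : Set E3) (hX : MeasurableSet X) (hXfin : volume X ≠ ⊤) :
    ∑' i : ℤ, (a * f i + b) * (volume (X ∩ laySlab L s i)).toReal =
      a * ∑' i : ℤ, f i * (volume (X ∩ laySlab L s i)).toReal + b * (volume X).toReal := by
  have hA : 0 ≤ A := (hf0 0).trans (hfA 0)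
  rw [tsum_flux_add_const L s (fun i => a * f i) A b (fun i => mul_nonneg ha0 (hf0 i))
    (fun i => (mul_le_mul_of_nonneg_left (hfA i) ha0).trans (by nlinarith)) X hX hXfin, ← tsum_mul_left]
  congr 1
  exact tsum_congr fun i => by ring

set_option maxHeartbeats 400000 in
/-- **The wall cell's charge against a per-plate mixture of zigzag lines and in-layer rows.**  See the module docstring. -/
theorem cell_charge_le_lines_mix {σ₁ σ₂ : ℤ → ℤ} (hσ₁ : IsHaggSeq σ₁) (hσ₂ : IsHaggSeq σ₂)
    (L₁ L₂ : E3 ≃ₗᵢ[ℝ] E3) (s₁ s₂ : E3) (τ₀ R₀ h ρ : ℝ) (hτ₀ : 1 / 4 ≤ τ₀) (hR₀ : 1 ≤ R₀) (hh : 0 ≤ h) (hρ : 0 ≤ ρ)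
    {a₁ b₁ a₂ b₂ : ℝ} (ha₁ : 0 ≤ a₁) (ha₁1 : a₁ ≤ 1) (hb₁ : 0 ≤ b₁) (hb₁1 : b₁ ≤ 1) (ha₂ : 0 ≤ a₂) (ha₂1 : a₂ ≤ 1)
    (hb₂ : 0 ≤ b₂) (hb₂1 : b₂ ≤ 1)
    (c : ℤ → ℤ → ℝ) (hc0 : ∀ i j, 0 ≤ c i j) (hdom : MixFluxDominated τ₀ a₁ b₁ a₂ b₂ L₁ σ₁ L₂ σ₂ c)
    {step₁ : ℤ → E3} (hsel₁ : IsZigSelector L₁ σ₁ e₃ step₁) {step₂ : ℤ → E3} (hsel₂ : IsZigSelector L₂ σ₂ (-e₃) step₂)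
    (T₁ T₂ : Finset (Fin 2 → ℤ)) (T₃ T₄ : Finset (ℤ × ℤ))
    (hT₁ : ∀ t : Fin 2 → ℤ, (∃ k : ℤ,
        -R₀ - 4 ≤ (L₁ (zigVertexS step₁ k + ((t 0 : ℝ) • triangularVec₁ 1 + (t 1 : ℝ) • triangularVec₂ 1)) + s₁) 2 ∧
        (L₁ (zigVertexS step₁ k + ((t 0 : ℝ) • triangularVec₁ 1 + (t 1 : ℝ) • triangularVec₂ 1)) + s₁) 2 ≤ -R₀ - 3 ∧
        Real.sqrt ((L₁ (zigVertexS step₁ k + ((t 0 : ℝ) • triangularVec₁ 1 + (t 1 : ℝ) • triangularVec₂ 1)) + s₁) 0 ^ 2 +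
          (L₁ (zigVertexS step₁ k + ((t 0 : ℝ) • triangularVec₁ 1 + (t 1 : ℝ) • triangularVec₂ 1)) + s₁) 1 ^ 2) ≤ ρ) →
        t ∈ T₁)
    (hT₂ : ∀ t : Fin 2 → ℤ, (∃ k : ℤ,
        h + R₀ + 3 ≤ (L₂ (zigVertexS step₂ k + ((t 0 : ℝ) • triangularVec₁ 1 + (t 1 : ℝ) • triangularVec₂ 1)) + s₂) 2 ∧
        (L₂ (zigVertexS step₂ k + ((t 0 : ℝ) • triangularVec₁ 1 + (t 1 : ℝ) • triangularVec₂ 1)) + s₂) 2 ≤ h + R₀ + 4 ∧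
        Real.sqrt ((L₂ (zigVertexS step₂ k + ((t 0 : ℝ) • triangularVec₁ 1 + (t 1 : ℝ) • triangularVec₂ 1)) + s₂) 0 ^ 2 +
          (L₂ (zigVertexS step₂ k + ((t 0 : ℝ) • triangularVec₁ 1 + (t 1 : ℝ) • triangularVec₂ 1)) + s₂) 1 ^ 2) ≤ ρ) →
        t ∈ T₂)
    (hT₃ : ∀ kj : ℤ × ℤ, (∃ i : ℤ,
        -R₀ - 4 ≤ (L₁ (layerSite σ₁ L₁ e₃ kj.1 i kj.2) + s₁) 2 ∧ (L₁ (layerSite σ₁ L₁ e₃ kj.1 i kj.2) + s₁) 2 ≤ -R₀ - 3 ∧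
        Real.sqrt ((L₁ (layerSite σ₁ L₁ e₃ kj.1 i kj.2) + s₁) 0 ^ 2 + (L₁ (layerSite σ₁ L₁ e₃ kj.1 i kj.2) + s₁) 1 ^ 2) ≤ ρ) →
        kj ∈ T₃)
    (hT₄ : ∀ kj : ℤ × ℤ, (∃ i : ℤ,
        h + R₀ + 3 ≤ (L₂ (layerSite σ₂ L₂ (-e₃) kj.1 i kj.2) + s₂) 2 ∧
        (L₂ (layerSite σ₂ L₂ (-e₃) kj.1 i kj.2) + s₂) 2 ≤ h + R₀ + 4 ∧
        Real.sqrt ((L₂ (layerSite σ₂ L₂ (-e₃) kj.1 i kj.2) + s₂) 0 ^ 2 +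
          (L₂ (layerSite σ₂ L₂ (-e₃) kj.1 i kj.2) + s₂) 1 ^ 2) ≤ ρ) →
        kj ∈ T₄) :
    2 * ∑' ij : ℤ × ℤ, c ij.1 ij.2 * (volume (wallSlice ρ ∩ laySlab L₁ s₁ ij.1 ∩ laySlab L₂ s₂ ij.2)).toReal ≤
      a₁ * (T₁.card : ℝ) + a₂ * T₂.card + b₁ * T₃.card + b₂ * T₄.card + 160 * (R₀ + 9) * (1 + h) * ρ := by
  have he₃ : ‖(e₃ : E3)‖ = 1 := by rw [e₃, PiLp.norm_single, norm_one]
  have hne₃ : ‖(-e₃ : E3)‖ = 1 := by rw [norm_neg, he₃]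
  have hi₃ : ∀ p : E3, ⟪p, e₃⟫_ℝ = p 2 := fun p => by
    rw [e₃, EuclideanSpace.inner_single_right]; simp
  have hs2 : 0 ≤ Real.sqrt 2 := Real.sqrt_nonneg 2
  -- the two mixed fluxes, bounded by `2√2`
  set κ₁ : ℤ → ℝ := fun i => a₁ * plateFlux τ₀ L₁ σ₁ e₃ i + b₁ * layerFlux τ₀ L₁ e₃ with hκ₁
  set κ₂ : ℤ → ℝ := fun j => a₂ * plateFlux τ₀ L₂ σ₂ (-e₃) j + b₂ * layerFlux τ₀ L₂ (-e₃) with hκ₂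
  have hκ₁0 : ∀ i, 0 ≤ κ₁ i := fun i =>
    add_nonneg (mul_nonneg ha₁ (plateFlux_nonneg τ₀ L₁ σ₁ he₃ i)) (mul_nonneg hb₁ (layerFlux_nonneg τ₀ L₁ e₃))
  have hκ₂0 : ∀ j, 0 ≤ κ₂ j := fun j =>
    add_nonneg (mul_nonneg ha₂ (plateFlux_nonneg τ₀ L₂ σ₂ hne₃ j)) (mul_nonneg hb₂ (layerFlux_nonneg τ₀ L₂ (-e₃)))
  have hκ₁B : ∀ i, κ₁ i ≤ 2 * Real.sqrt 2 := fun i => by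
    have h1 := plateFlux_le_sqrt_two τ₀ L₁ σ₁ he₃ i; have h2 := layerFlux_le_sqrt_two τ₀ L₁ he₃
    have h3 := plateFlux_nonneg τ₀ L₁ σ₁ he₃ i; have h4 := layerFlux_nonneg τ₀ L₁ e₃
    simp only [hκ₁]; nlinarith
  have hκ₂B : ∀ j, κ₂ j ≤ 2 * Real.sqrt 2 := fun j => by
    have h1 := plateFlux_le_sqrt_two τ₀ L₂ σ₂ hne₃ j; have h2 := layerFlux_le_sqrt_two τ₀ L₂ hne₃
    have h3 := plateFlux_nonneg τ₀ L₂ σ₂ hne₃ j; have h4 := layerFlux_nonneg τ₀ L₂ (-e₃)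
    simp only [hκ₂]; nlinarith
  have hdomκ : ∀ i j, c i j ≤ (κ₁ i + κ₂ j) / 2 := fun i j => by simp only [hκ₁, hκ₂]; exact hdom i j
  have hcB : ∀ i j, c i j ≤ 2 * Real.sqrt 2 := fun i j => (hdomκ i j).trans (by linarith [hκ₁B i, hκ₂B j])
  have h418 := four_sqrt_two_pi_le
  have hπ0 := Real.pi_pos.le
  set d : ℝ := 4 * h + 4 * R₀ + 36 with hd
  have hd0 : 0 ≤ d := by rw [hd]; positivity
  have hdle : d ≤ 4 * (R₀ + 9) * (1 + h) := by rw [hd]; nlinarith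
  have hT0 : (0 : ℝ) ≤ a₁ * (T₁.card : ℝ) + a₂ * T₂.card + b₁ * T₃.card + b₂ * T₄.card := by positivity
  have hSfin : ∀ r, 0 ≤ r → volume (wallSlice r) ≠ ⊤ := fun r hr => by rw [volume_wallSlice r hr]; exact ENNReal.ofReal_ne_top
  by_cases hsmall : ρ ≤ d
  · -- degenerate: the whole slice is rim
    have h1 := two_charge_le_const L₁ L₂ s₁ s₂ c (2 * Real.sqrt 2) hc0 hcB (wallSlice ρ) (measurableSet_wallSlice ρ) (hSfin ρ hρ)
    rw [volume_wallSlice ρ hρ, ENNReal.toReal_ofReal (by positivity)] at h1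
    have h2 : Real.pi * ρ ^ 2 ≤ Real.pi * (ρ * d) := mul_le_mul_of_nonneg_left (by nlinarith) hπ0
    have h3 : 2 * (2 * Real.sqrt 2) * (Real.pi * (ρ * d)) ≤ 160 * (R₀ + 9) * (1 + h) * ρ := by
      have : 2 * (2 * Real.sqrt 2) * (Real.pi * (ρ * d)) = (4 * Real.sqrt 2 * Real.pi) * d * ρ := by ring
      rw [this]
      have h5 : (4 * Real.sqrt 2 * Real.pi) * d ≤ 18 * (4 * (R₀ + 9) * (1 + h)) := mul_le_mul h418 hdle hd0 (by norm_num)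
      nlinarith
    nlinarith [mul_le_mul_of_nonneg_left h2 (by positivity : 0 ≤ 2 * (2 * Real.sqrt 2))]
  -- the shrunken slice and the annulus
  push Not at hsmall
  set ρ' : ℝ := ρ - d with hρ'
  have hρ'0 : 0 ≤ ρ' := by rw [hρ']; linarith
  have hρ'ρ : ρ' ≤ ρ := by rw [hρ']; linarith
  set S : Set E3 := wallSlice ρ with hS
  set S' : Set E3 := wallSlice ρ' with hS'
  set ann : Set E3 := S \ S' with hann
  have hS'S : S' ⊆ S := wallSlice_mono hρ'ρ hρ'0
  have hSm : MeasurableSet S := measurableSet_wallSlice ρ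
  have hS'm : MeasurableSet S' := measurableSet_wallSlice ρ'
  have hannm : MeasurableSet ann := hSm.diff hS'm
  have hannfin : volume ann ≠ ⊤ := ne_top_of_le_ne_top (hSfin ρ hρ) (measure_mono Set.sdiff_subset)
  -- split the charge
  set f : Set E3 → ℤ × ℤ → ℝ := fun X ij => c ij.1 ij.2 * (volume (X ∩ laySlab L₁ s₁ ij.1 ∩ laySlab L₂ s₂ ij.2)).toReal with hf
  have hsplit : ∀ ij, f S ij = f S' ij + f ann ij := by
    intro ij
    simp only [hf]
    have hset : S ∩ laySlab L₁ s₁ ij.1 ∩ laySlab L₂ s₂ ij.2 =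
        (S' ∩ laySlab L₁ s₁ ij.1 ∩ laySlab L₂ s₂ ij.2) ∪ (ann ∩ laySlab L₁ s₁ ij.1 ∩ laySlab L₂ s₂ ij.2) := by
      rw [← Set.union_inter_distrib_right, ← Set.union_inter_distrib_right, hann, Set.union_sdiff_cancel hS'S]
    have hdisj : Disjoint (S' ∩ laySlab L₁ s₁ ij.1 ∩ laySlab L₂ s₂ ij.2) (ann ∩ laySlab L₁ s₁ ij.1 ∩ laySlab L₂ s₂ ij.2) :=
      (Set.disjoint_sdiff_right).mono (Set.inter_subset_left.trans Set.inter_subset_left)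
        (Set.inter_subset_left.trans Set.inter_subset_left)
    rw [hset, measure_union hdisj ((hannm.inter (measurableSet_laySlab L₁ s₁ _)).inter (measurableSet_laySlab L₂ s₂ _)),
      ENNReal.toReal_add (ne_top_of_le_ne_top (hSfin ρ' hρ'0) (measure_mono (Set.inter_subset_left.trans Set.inter_subset_left)))
        (ne_top_of_le_ne_top hannfin (measure_mono (Set.inter_subset_left.trans Set.inter_subset_left))), mul_add]
  have hsumS' := summable_charge L₁ L₂ s₁ s₂ c (2 * Real.sqrt 2) hc0 hcB S' hS'm (hSfin ρ' hρ'0)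
  have hsumA := summable_charge L₁ L₂ s₁ s₂ c (2 * Real.sqrt 2) hc0 hcB ann hannm hannfin
  have hQ : ∑' ij, f S ij = ∑' ij, f S' ij + ∑' ij, f ann ij := by
    rw [← hsumS'.tsum_add hsumA]; exact tsum_congr hsplit
  -- the shrunken slice: flux, split into the weighted zigzag and in-layer parts
  have hflux := charge_le_flux L₁ L₂ s₁ s₂ κ₁ κ₂ c (2 * Real.sqrt 2) hκ₁0 hκ₁B hκ₂0 hκ₂B hc0 hdomκ S' hS'm (hSfin ρ' hρ'0)
  have hsplit₁ := tsum_flux_scale_add_const L₁ s₁ (plateFlux τ₀ L₁ σ₁ e₃) (Real.sqrt 2) a₁ (b₁ * layerFlux τ₀ L₁ e₃)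
    (plateFlux_nonneg τ₀ L₁ σ₁ he₃) (plateFlux_le_sqrt_two τ₀ L₁ σ₁ he₃) ha₁ ha₁1 S' hS'm (hSfin ρ' hρ'0)
  have hsplit₂ := tsum_flux_scale_add_const L₂ s₂ (plateFlux τ₀ L₂ σ₂ (-e₃)) (Real.sqrt 2) a₂ (b₂ * layerFlux τ₀ L₂ (-e₃))
    (plateFlux_nonneg τ₀ L₂ σ₂ hne₃) (plateFlux_le_sqrt_two τ₀ L₂ σ₂ hne₃) ha₂ ha₂1 S' hS'm (hSfin ρ' hρ'0)
  simp only [hκ₁, hκ₂] at hflux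
  rw [hsplit₁, hsplit₂] at hflux
  -- plate 1: zigzag lines and rows
  have hS'sub₁ : S' ⊆ {p : E3 | (0 : ℝ) ≤ ⟪p, e₃⟫_ℝ ∧ ⟪p, e₃⟫_ℝ ≤ 0 + 1 ∧ Real.sqrt (p 0 ^ 2 + p 1 ^ 2) ≤ ρ'} := by
    rintro p ⟨h1, h2, h3⟩
    refine ⟨by rw [hi₃]; exact h1, by rw [hi₃]; linarith, ?_⟩
    rw [← Real.sqrt_sq hρ'0]; exact Real.sqrt_le_sqrt h3
  have hP₁ := plate_lines_ge_flux_sel hσ₁ L₁ s₁ e₃ he₃ hsel₁ τ₀ ρ' 0 (-R₀ - 4) (by linarith) S' hS'm (hSfin ρ' hρ'0) hS'sub₁ T₁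
    (fun t ⟨k, hk1, hk2, hk3⟩ => hT₁ t ⟨k, by rw [hi₃] at hk1; linarith, by rw [hi₃] at hk2; linarith,
      hk3.trans (by rw [hρ', hd]; linarith)⟩)
  have hR₁ := layer_lines_ge_flux σ₁ L₁ s₁ e₃ he₃ τ₀ hτ₀ ρ' 0 (-R₀ - 4) (by linarith) S' hS'm hS'sub₁ T₃
    (fun kj ⟨i, hk1, hk2, hk3⟩ => hT₃ kj ⟨i, by rw [hi₃] at hk1; linarith, by rw [hi₃] at hk2; linarith,
      hk3.trans (by rw [hρ', hd]; linarith)⟩)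
  -- plate 2
  have hS'sub₂ : S' ⊆ {p : E3 | (-1 : ℝ) ≤ ⟪p, -e₃⟫_ℝ ∧ ⟪p, -e₃⟫_ℝ ≤ -1 + 1 ∧ Real.sqrt (p 0 ^ 2 + p 1 ^ 2) ≤ ρ'} := by
    rintro p ⟨h1, h2, h3⟩
    refine ⟨by rw [inner_neg_right, hi₃]; linarith, by rw [inner_neg_right, hi₃]; linarith, ?_⟩
    rw [← Real.sqrt_sq hρ'0]; exact Real.sqrt_le_sqrt h3
  have hP₂ := plate_lines_ge_flux_sel hσ₂ L₂ s₂ (-e₃) hne₃ hsel₂ τ₀ ρ' (-1) (-h - R₀ - 4) (by linarith) S' hS'm (hSfin ρ' hρ'0)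
    hS'sub₂ T₂ (fun t ⟨k, hk1, hk2, hk3⟩ => hT₂ t ⟨k, by rw [inner_neg_right, hi₃] at hk2; linarith,
      by rw [inner_neg_right, hi₃] at hk1; linarith, hk3.trans (by rw [hρ', hd]; linarith)⟩)
  have hR₂ := layer_lines_ge_flux σ₂ L₂ s₂ (-e₃) hne₃ τ₀ hτ₀ ρ' (-1) (-h - R₀ - 4) (by linarith) S' hS'm hS'sub₂ T₄
    (fun kj ⟨i, hk1, hk2, hk3⟩ => hT₄ kj ⟨i, by rw [inner_neg_right, hi₃] at hk2; linarith,
      by rw [inner_neg_right, hi₃] at hk1; linarith, hk3.trans (by rw [hρ', hd]; linarith)⟩)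
  -- weighted family counts
  have hP₁' := mul_le_mul_of_nonneg_left hP₁ ha₁
  have hP₂' := mul_le_mul_of_nonneg_left hP₂ ha₂
  have hR₁' : b₁ * layerFlux τ₀ L₁ e₃ * (volume S').toReal ≤ b₁ * T₃.card := by
    rw [mul_assoc]; exact mul_le_mul_of_nonneg_left hR₁ hb₁
  have hR₂' : b₂ * layerFlux τ₀ L₂ (-e₃) * (volume S').toReal ≤ b₂ * T₄.card := by
    rw [mul_assoc]; exact mul_le_mul_of_nonneg_left hR₂ hb₂
  -- the annulus
  have hA := two_charge_le_const L₁ L₂ s₁ s₂ c (2 * Real.sqrt 2) hc0 hcB ann hannm hannfin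
  have hvolann : (volume ann).toReal = Real.pi * ρ ^ 2 - Real.pi * ρ' ^ 2 := by
    have hu : volume S = volume S' + volume ann := by
      rw [← measure_union (Set.disjoint_sdiff_right) hannm, Set.union_sdiff_cancel hS'S]
    rw [hS, hS', volume_wallSlice ρ hρ, volume_wallSlice ρ' hρ'0] at hu
    have h1 : volume ann = ENNReal.ofReal (Real.pi * ρ ^ 2) - ENNReal.ofReal (Real.pi * ρ' ^ 2) :=
      (ENNReal.sub_eq_of_eq_add_rev ENNReal.ofReal_ne_top hu).symm
    rw [h1, ← ENNReal.ofReal_sub _ (by positivity), ENNReal.toReal_ofReal]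
    nlinarith [mul_le_mul_of_nonneg_left (pow_le_pow_left₀ hρ'0 hρ'ρ 2) hπ0]
  have hannle : (volume ann).toReal ≤ 2 * Real.pi * ρ * d := by
    rw [hvolann, hρ']; nlinarith [mul_nonneg hπ0 (sq_nonneg d)]
  -- assemble
  have hmain : 2 * ∑' ij, f S ij ≤
      a₁ * (T₁.card : ℝ) + a₂ * T₂.card + b₁ * T₃.card + b₂ * T₄.card + 2 * (2 * Real.sqrt 2) * (2 * Real.pi * ρ * d) := by
    rw [hQ, mul_add]
    have h1 : 2 * ∑' ij, f S' ij ≤ a₁ * (T₁.card : ℝ) + a₂ * T₂.card + b₁ * T₃.card + b₂ * T₄.card := by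
      simp only [hf] at hflux ⊢; linarith
    have h2 : 2 * ∑' ij, f ann ij ≤ 2 * (2 * Real.sqrt 2) * (2 * Real.pi * ρ * d) := by
      simp only [hf] at hA ⊢
      exact hA.trans (mul_le_mul_of_nonneg_left hannle (by positivity))
    linarith
  have hconst : 2 * (2 * Real.sqrt 2) * (2 * Real.pi * ρ * d) ≤ 160 * (R₀ + 9) * (1 + h) * ρ := by
    have : 2 * (2 * Real.sqrt 2) * (2 * Real.pi * ρ * d) = 2 * ((4 * Real.sqrt 2 * Real.pi) * d * ρ) := by ring
    rw [this]
    have h5 : (4 * Real.sqrt 2 * Real.pi) * d ≤ 18 * (4 * (R₀ + 9) * (1 + h)) := mul_le_mul h418 hdle hd0 (by norm_num)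
    have h6 : (4 * Real.sqrt 2 * Real.pi) * d * ρ ≤ 18 * (4 * (R₀ + 9) * (1 + h)) * ρ := mul_le_mul_of_nonneg_right h5 hρ
    have hY : 0 ≤ (R₀ + 9) * (1 + h) * ρ := mul_nonneg (mul_nonneg (by linarith) (by linarith)) hρ
    linarith only [h6, hY]
  simp only [hf] at hmain
  linarith

end Summit.Ventures.Crystal3D.Theorems

end
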